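import Literature.NumberTheory.Sieve.HeathBrownCubicTypeIMoebius
import Mathlib.NumberTheory.EulerProduct.Basic
import Mathlib.NumberTheory.ArithmeticFunction.Moebius
import HarnessLib

/-!
# Heath-Brown 2001 (PLMS), Lemma 11, (7.4): `∑_d μ(d)(r,d)/d² = (6/π²) ∏_{p∣r} (1 + 1/p)⁻¹`

Topic `Literature/NumberTheory/Sieve`; a PROVED arithmetic layer (definitions with bodies, no named facts)
under the named fact `Irving2015_largestPrimeFactor_cubic` (`LargestPrimeFactorCubic.lean`), the main
term of Heath-Brown's **Lemma 11** (main-term programme, Lemma 7).  Source: D. R. Heath-Brown, *The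
largest prime factor of `X³ + 2`*, Proc. London Math. Soc. (3) 82 (2001) 554–596, §7 p. 25, (7.4): "if
`ρ(R) = 1` we have `∑_{d=1}^∞ μ(d) (M²/d²) N(R/(R,d))⁻¹ = (M²/N(R)) ∑_d μ(d)/(d² N((R,d))⁻¹)
= (M²/N(R)) ∏_{p∤N(R)} (1 − 1/p²) ∏_{p∣N(R)} (1 − 1/p) = (6M²/(π²N(R))) ∏_{p∣N(R)} (1 + 1/p)⁻¹`",
the `γ(R) = ∏_{p∣N(R)}(1 + 1/p)⁻¹` of Lemma 11.  In root language `N((R,d)) = (r, d)` for `r = N(R)`,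
`ρ(R) = 1`, so the identity is about the multiplicative function `d ↦ μ(d)(r,d)/d²`:

* `gammaR r = ∏_{p∣r} p/(p+1)` (`= γ`), `mobGcd r` (the arithmetic function `μ(d)(r,d)/d²`),
  `isMultiplicative_mobGcd`, `summable_norm_mobGcd`;
* (`∏_{p<N} (1 − 1/p²) → 6/π²` is the tree's `CubicSieve.tendsto_prod_primesBelow_one_sub_inv_sq`);
* **`tsum_mobGcd`** — `∑_d μ(d)(r,d)/d² = (6/π²) γ(r)` (`r ≥ 1`).

## References

* D. R. Heath-Brown, *The largest prime factor of `X³ + 2`*, Proc. London Math. Soc. (3) 82 (2001)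
  554–596, §7 (7.4) p. 25. [`HeathBrown2001LargestPrimeFactorCubic`]

## Mathlib / tree search

Tree: `CubicSieve.tendsto_prod_primesBelow_one_sub_inv_sq` (`HeathBrownCubicTypeIMoebius`).
Mathlib: `EulerProduct.eulerProduct`, `ArithmeticFunction.isMultiplicative_moebius`, `Nat.Coprime.gcd_mul`,
`ArithmeticFunction.moebius_apply_prime_pow`, `Real.summable_one_div_nat_pow`.
-/

noncomputable section

open Finset Filter Topology ArithmeticFunction
open scoped ArithmeticFunction.Moebius

namespace Literature.NumberTheory.Sieve.HeathBrown2001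

-- `∏_{p<N} (1 − p⁻²) → 6/π²` is the tree's `CubicSieve.tendsto_prod_primesBelow_one_sub_inv_sq`.

/-! ### `γ(r)` and the function `μ(d)(r,d)/d²` -/

/-- `γ(r) = ∏_{p∣r} (1 + 1/p)⁻¹ = ∏_{p∣r} p/(p+1)` (Heath-Brown's `γ(R)`, `r = N(R)`).
[cite: HeathBrown2001LargestPrimeFactorCubic, Lemma 11 p. 25] -/
def gammaR (r : ℕ) : ℝ := ∏ p ∈ r.primeFactors, (p : ℝ) / (p + 1)

/-- `0 < γ(r) ≤ 1`. [folklore] -/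
theorem gammaR_pos_le (r : ℕ) : 0 < gammaR r ∧ gammaR r ≤ 1 := by
  unfold gammaR
  refine ⟨prod_pos fun p hp => ?_, prod_le_one (fun p _ => by positivity) fun p _ => ?_⟩
  · have := (Nat.prime_of_mem_primeFactors hp).pos; positivity
  · rw [div_le_one (by positivity)]; linarith

/-- The arithmetic function `d ↦ μ(d)(r,d)/d²`. [cite: HeathBrown2001LargestPrimeFactorCubic, §7 (7.4)] -/
def mobGcd (r : ℕ) : ArithmeticFunction ℝ :=
  ⟨fun d => (μ d : ℝ) * (Nat.gcd r d : ℝ) / (d : ℝ) ^ 2, by simp⟩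

/-- `mobGcd r d` unfolded. [folklore] -/
theorem mobGcd_apply (r d : ℕ) : mobGcd r d = (μ d : ℝ) * (Nat.gcd r d : ℝ) / (d : ℝ) ^ 2 := rfl

/-- `d ↦ μ(d)(r,d)/d²` is multiplicative. [folklore] -/
theorem isMultiplicative_mobGcd (r : ℕ) : (mobGcd r).IsMultiplicative := by
  refine ⟨by simp [mobGcd_apply], fun {m n} hmn => ?_⟩
  rw [mobGcd_apply, mobGcd_apply, mobGcd_apply, isMultiplicative_moebius.map_mul_of_coprime hmn,
    Nat.Coprime.gcd_mul r hmn]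
  push_cast
  have : ((m : ℝ) * n) ^ 2 = (m : ℝ) ^ 2 * (n : ℝ) ^ 2 := by ring
  rw [this]
  rcases eq_or_ne m 0 with rfl | hm
  · simp
  rcases eq_or_ne n 0 with rfl | hn
  · simp
  field_simp

/-- `|μ(d)(r,d)/d²| ≤ r/d²`, so the series converges absolutely (`r ≥ 1`). [folklore] -/
theorem summable_norm_mobGcd {r : ℕ} (hr : 0 < r) : Summable fun d : ℕ => ‖mobGcd r d‖ := by
  have hs : Summable fun d : ℕ => (r : ℝ) * (1 / (d : ℝ) ^ 2) :=
    (Real.summable_one_div_nat_pow.mpr one_lt_two).mul_left _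
  refine Summable.of_nonneg_of_le (fun _ => norm_nonneg _) (fun d => ?_) hs
  rw [mobGcd_apply, Real.norm_eq_abs, abs_div, abs_mul, abs_of_nonneg (by positivity : (0 : ℝ) ≤ (d : ℝ) ^ 2)]
  rcases Nat.eq_zero_or_pos d with rfl | hd
  · simp
  rw [mul_one_div, div_le_div_iff_of_pos_right (by positivity)]
  have h1 : |(μ d : ℝ)| ≤ 1 := by exact_mod_cast abs_moebius_le_one (n := d)
  have h2 : |((Nat.gcd r d : ℕ) : ℝ)| ≤ r := by
    rw [Nat.abs_cast]; exact_mod_cast Nat.le_of_dvd hr (Nat.gcd_dvd_left r d)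
  calc |(μ d : ℝ)| * |((Nat.gcd r d : ℕ) : ℝ)| ≤ 1 * r := mul_le_mul h1 h2 (abs_nonneg _) zero_le_one
    _ = r := one_mul _

/-- The Euler factor at `p`: `∑_e mobGcd r (p^e) = 1 − (r,p)/p²`. [folklore] -/
theorem tsum_mobGcd_prime_pow (r : ℕ) {p : ℕ} (hp : p.Prime) :
    ∑' e : ℕ, mobGcd r (p ^ e) = 1 - (Nat.gcd r p : ℝ) / (p : ℝ) ^ 2 := by
  rw [tsum_eq_sum (s := Finset.range 2) (fun e he => ?_)]
  · rw [Finset.sum_range_succ, Finset.sum_range_one, pow_zero, (isMultiplicative_mobGcd r).map_one, pow_one,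
      mobGcd_apply, moebius_apply_prime hp]
    push_cast; ring
  · rw [Finset.mem_range, not_lt] at he
    rw [mobGcd_apply, moebius_apply_prime_pow hp (by omega), if_neg (by omega)]
    simp

/-- The Euler factor, split: `1 − (r,p)/p² = (1 − 1/p²) · (p/(p+1) if p ∣ r, else 1)`. [folklore] -/
theorem euler_factor_mobGcd (r : ℕ) {p : ℕ} (hp : p.Prime) :
    1 - (Nat.gcd r p : ℝ) / (p : ℝ) ^ 2 =
      (1 - ((p : ℝ) ^ 2)⁻¹) * (if p ∣ r then (p : ℝ) / (p + 1) else 1) := by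
  have hp0 : (0 : ℝ) < p := by exact_mod_cast hp.pos
  by_cases h : p ∣ r
  · rw [if_pos h, Nat.gcd_eq_right h]
    field_simp
    ring
  · rw [if_neg h, mul_one]
    have : Nat.gcd r p = 1 := (Nat.Coprime.symm ((hp.coprime_iff_not_dvd).mpr h))
    rw [this]; push_cast; rw [one_div]

/-- **(7.4)**: `∑_d μ(d)(r,d)/d² = (6/π²) γ(r)` for `r ≥ 1`.
[cite: HeathBrown2001LargestPrimeFactorCubic, §7 (7.4) p. 25] -/
theorem tsum_mobGcd {r : ℕ} (hr : 0 < r) : ∑' d : ℕ, mobGcd r d = 6 / Real.pi ^ 2 * gammaR r := by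
  have hmul : ∀ {m n : ℕ}, Nat.Coprime m n → mobGcd r (m * n) = mobGcd r m * mobGcd r n :=
    fun hmn => (isMultiplicative_mobGcd r).map_mul_of_coprime hmn
  have h := EulerProduct.eulerProduct (f := fun d : ℕ => mobGcd r d) (isMultiplicative_mobGcd r).map_one hmul
    (summable_norm_mobGcd hr) (by simp)
  -- the partial products, for `N > r`, are `(∏_{p<N} (1 − p⁻²)) · γ(r)`
  have hprod : ∀ᶠ N : ℕ in atTop, ∏ p ∈ Nat.primesBelow N, ∑' e : ℕ, mobGcd r (p ^ e) =
      (∏ p ∈ Nat.primesBelow N, (1 - ((p : ℝ) ^ 2)⁻¹)) * gammaR r := by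
    filter_upwards [eventually_gt_atTop r] with N hN
    rw [prod_congr rfl fun p hp => (tsum_mobGcd_prime_pow r (Nat.prime_of_mem_primesBelow hp)).trans
      (euler_factor_mobGcd r (Nat.prime_of_mem_primesBelow hp)), prod_mul_distrib, prod_ite, prod_const_one,
      mul_one]
    congr 1
    unfold gammaR
    refine prod_congr ?_ fun _ _ => rfl
    ext p
    rw [mem_filter, Nat.mem_primesBelow, Nat.mem_primeFactors]
    constructor
    · rintro ⟨⟨-, hp⟩, hpr⟩; exact ⟨hp, hpr, hr.ne'⟩
    · rintro ⟨hp, hpr, -⟩; exact ⟨⟨(Nat.le_of_dvd hr hpr).trans_lt hN, hp⟩, hpr⟩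
  have h2 : Tendsto (fun N : ℕ => (∏ p ∈ Nat.primesBelow N, (1 - ((p : ℝ) ^ 2)⁻¹)) * gammaR r) atTop
      (𝓝 (6 / Real.pi ^ 2 * gammaR r)) := CubicSieve.tendsto_prod_primesBelow_one_sub_inv_sq.mul_const _
  exact tendsto_nhds_unique (h.congr' hprod) h2

end Literature.NumberTheory.Sieve.HeathBrown2001
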